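/-
Copyright (c) 2026 the pub-hodgecm-mathlib formalisation cell (harness21).  Prover seat hodgecm-mathlib-LH7-p04 (g11), 2026-09-02.
Road M6 → F3 «TOT-Λ BY OVER-ORDERS» (dealer LH4-plan (g8) WORD #69∕#71∕#74), brick F3-2b, FILE 1 «TRANSPORT LEMMAS».
-/
import Literature.NumberTheory.Automorphic.CyclicSelfDualLatticeTorsor   -- ★ [T2-a] (F0P3b-p01): cyclic-vector lemmas `exists_sum_smul_pow_mulVec_eq`, `eq_zero_of_commute_of_mulVec_eq_zero`, ★ lattice dictionary
import HarnessLib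

/-!
# Transport lemmas for self-dual lattices: the cyclic-vector isomorphism, self-duality in membership form, three generators to two

Topic `NumberTheory/Automorphic`; namespace `Literature.NumberTheory.Automorphic`.  THEOREMS ONLY (no definition, no instance, no notation, no named fact, no `sorry`).
Cell `pub/hodgecm-mathlib` (D-0151), crux H413 = `stmt-HodgeConjecture-24833`; road M6 → F3 «TOT-Λ by over-orders», brick **F3-2b FILE 1** (the three inputs of the
transport of ★ (O4-G) `exists_generator_of_selfDual_glued` to ★ [T2-a]∕★ F3-2a operator currency; FILE 2 `SelfDualCyclicOverOrderPartition` does the transport).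
Currency of ★ [T2-a] `CyclicSelfDualLatticeTorsor`: a valued field `E` (`ValuativeRel E`), an involution `σ`, a `σ`-hermitian `J ∈ GL_n(𝒪)`, lattices `Λ(g) = span_𝒪 (cols g)`, a regular
`τ` with cyclic vector `w₀`, a commutative carrier `φ : B → M_n(E)`.  NO `2`, NO `d`, NO discreteness.
HONEST LABEL: HC_CM is proved only modulo the 2 remaining named inputs (hLiu418 24832, h413 24833) until rung 0 closes; elementary linear algebra over a valuation ring,
asserts nothing printed; count-neutral base-layer brick ((O4) is not an organ).

THE MATHEMATICS.  (T1) The orbit map of the cyclic vector, `ψ : b ↦ φ(b)·w₀`, is onto `Eⁿ` (every `w` is `(Σ c_j τ^j)·w₀ = φ(Σ c_j τ_B^j)·w₀`) and injective (`φ(b)·w₀ = 0 ⇒ φ b = 0`),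
and intertwines `φ(x)` with multiplication by `x`.  (T2) SELF-DUALITY IN MEMBERSHIP FORM: for `u ∈ U(σ, J)`, `J ∈ GL_n(𝒪)`: `x ∈ Λ(u) ⟺ ∀ y ∈ Λ(u), σ(y)ᵀ J x ∈ 𝒪`
(`σ(u)ᵀ J = J u⁻¹`).  (T3) THREE GENERATORS TO TWO in a plane: if `x₀, x₁` are `E`-independent and `x₂ = αx₀ + βx₁`, then `span_𝒪{x₀, x₁, x₂} = span_𝒪{a, b}` with `{a, b}` two of
the three and `E`-independent — drop the generator carrying the coefficient of largest valuation (a valuation ring is Bézout); and any `E`-independent pair `a, b` of a two-dimensional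
commutative `E`-algebra `K` (a field) satisfies `(b∕a)² = s·(b∕a) − m` for some `s, m ∈ E`.

* §1 `exists_map_mulVec_eq`, `eq_zero_of_map_mulVec_eq_zero`, `map_mul_mulVec`.
* §2 `dotProduct_map_mulVec_eq`, `dotProduct_mulVec_mem_integer`, `mulVec_apply_mem_integer_of_forall`, **`mem_span_range_transpose_iff_forall_dotProduct_mem`**.
* §3 `exists_span_triple_eq_span_pair_of_le`, **`exists_span_triple_eq_span_pair`**, **`exists_span_range_eq_span_pair`**, `exists_sq_eq_of_linearIndependent`.

## References
* [Jacobowitz1962] R. Jacobowitz, *Hermitian forms over local fields*, Amer. J. Math. 84 (1962): §4 (dual lattices, unimodular lattices).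
* [Serre1980Trees] J.-P. Serre, *Trees* (1980): Ch. II §1.1 (lattices over valuation rings).
* [HornJohnson2013] R. A. Horn, C. R. Johnson, *Matrix Analysis* (2nd ed. 2013): §3.2.4 (non-derogatory matrices and cyclic vectors).
-/

set_option autoImplicit false

noncomputable section

open Matrix
open scoped ValuativeRel MatrixGroups

namespace Literature.NumberTheory.Automorphic

open Literature.NumberTheory.Automorphic.UnitaryGroup

/-! ## §1 The orbit map of the cyclic vector -/

section Cyclic

variable {E : Type*} [Field E] {n : ℕ} {B : Type*} [CommRing B] [Algebra E B]
  (τ : Matrix (Fin n) (Fin n) E) {w₀ : Fin n → E} (hK : IsUnit (Matrix.of fun i j : Fin n => ((τ ^ (j : ℕ)) *ᵥ w₀) i).det)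
  (φ : B →ₐ[E] Matrix (Fin n) (Fin n) E) (hφ : Function.Injective φ) (τB : B) (hτB : φ τB = τ)

include hK hτB in
/-- **(T1, onto)** every vector is `φ(b)·w₀`: `w = (Σ c_j τ^j)·w₀ = φ(Σ c_j τ_B^j)·w₀`. [cite: HornJohnson2013, §3.2.4] -/
theorem exists_map_mulVec_eq (w : Fin n → E) : ∃ b : B, φ b *ᵥ w₀ = w := by
  obtain ⟨c, hc⟩ := exists_sum_smul_pow_mulVec_eq τ hK w
  refine ⟨∑ j : Fin n, c j • τB ^ (j : ℕ), ?_⟩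
  rw [← hc, map_sum]
  congr 1
  exact Finset.sum_congr rfl fun j _ => by rw [map_smul, map_pow, hτB]

include hK hφ hτB in
/-- **(T1, one-to-one)** `φ(b)·w₀ = 0 ⇒ b = 0` (cyclicity of `w₀` and injectivity of `φ`). [cite: HornJohnson2013, §3.2.4] -/
theorem eq_zero_of_map_mulVec_eq_zero {b : B} (hb : φ b *ᵥ w₀ = 0) : b = 0 := by
  have h := eq_zero_of_commute_of_mulVec_eq_zero τ (φ b) (commute_map_of_eq τ φ τB hτB b) hK hb
  exact hφ (by rw [h, map_zero])

/-- `ψ` intertwines: `φ(x b)·w = φ(x)·(φ(b)·w)`. [cite: HornJohnson2013, §3.2.4] -/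
theorem map_mul_mulVec (x b : B) (w : Fin n → E) : φ (x * b) *ᵥ w = φ x *ᵥ (φ b *ᵥ w) := by
  rw [map_mul, Matrix.mulVec_mulVec]

end Cyclic

/-! ## §2 Self-duality in membership form -/

section SelfDual

variable {E : Type*} [Field E] [ValuativeRel E] {n : ℕ} (σ : E →+* E) (hσO : ∀ x : 𝒪[E], σ x ∈ 𝒪[E])
  (J : GL (Fin n) E) (hJ : J ∈ glInt n E)

omit [ValuativeRel E] in
/-- `σ(A c)ᵀ z = σ(c)ᵀ · (σA)ᵀ z` (moving a matrix across the `σ`-sesquilinear pairing). [cite: Jacobowitz1962, §4] -/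
theorem dotProduct_map_mulVec_eq (A : Matrix (Fin n) (Fin n) E) (c z : Fin n → E) :
    dotProduct (fun i => σ ((A *ᵥ c) i)) z = dotProduct (fun i => σ (c i)) ((A.map σ)ᵀ *ᵥ z) := by
  simp only [dotProduct, Matrix.mulVec, Matrix.transpose_apply, Matrix.map_apply, map_sum, map_mul, Finset.sum_mul, Finset.mul_sum]
  rw [Finset.sum_comm]
  exact Finset.sum_congr rfl fun j _ => Finset.sum_congr rfl fun i _ => by ring

/-- An `𝒪`-bilinear combination of integral vectors through an integral matrix is integral. [cite: Serre1980Trees, Ch. II §1.1] -/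
theorem dotProduct_mulVec_mem_integer {c d : Fin n → E} {M : Matrix (Fin n) (Fin n) E} (hc : ∀ i, c i ∈ 𝒪[E]) (hd : ∀ i, d i ∈ 𝒪[E])
    (hM : ∀ i j, M i j ∈ 𝒪[E]) : dotProduct c (M *ᵥ d) ∈ 𝒪[E] := by
  simp only [dotProduct, Matrix.mulVec]
  exact Subring.sum_mem _ fun i _ => Subring.mul_mem _ (hc i) (Subring.sum_mem _ fun j _ => Subring.mul_mem _ (hM i j) (hd j))

/-- Entries of `M v` are integral for `M`, `v` integral. [cite: Serre1980Trees, Ch. II §1.1] -/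
theorem mulVec_apply_mem_integer_of_forall {v : Fin n → E} {M : Matrix (Fin n) (Fin n) E} (hv : ∀ i, v i ∈ 𝒪[E]) (hM : ∀ i j, M i j ∈ 𝒪[E]) (i : Fin n) :
    (M *ᵥ v) i ∈ 𝒪[E] := by
  simp only [Matrix.mulVec, dotProduct]
  exact Subring.sum_mem _ fun j _ => Subring.mul_mem _ (hM i j) (hv j)

include hσO hJ in
/-- **(T2) SELF-DUALITY IN MEMBERSHIP FORM.**  For `u ∈ U(σ, J)` with `J ∈ GL_n(𝒪)` and `σ(𝒪) ⊆ 𝒪`: `x ∈ Λ(u) ⟺ ∀ y ∈ Λ(u), σ(y)ᵀ J x ∈ 𝒪` — the self-dual lattice equals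
its own dual (`σ(u)ᵀ J = J u⁻¹`; test against the columns of `u`). [cite: Jacobowitz1962, §4, §7] -/
theorem mem_span_range_transpose_iff_forall_dotProduct_mem {u : GL (Fin n) E} (hu : u ∈ unitaryGroupOfForm σ (J : Matrix (Fin n) (Fin n) E))
    (x : Fin n → E) :
    x ∈ Submodule.span 𝒪[E] (Set.range ((u : Matrix (Fin n) (Fin n) E))ᵀ) ↔
      ∀ y ∈ Submodule.span 𝒪[E] (Set.range ((u : Matrix (Fin n) (Fin n) E))ᵀ),
        dotProduct (fun i => σ (y i)) ((J : Matrix (Fin n) (Fin n) E) *ᵥ x) ∈ 𝒪[E] := by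
  have hU : ((u : Matrix (Fin n) (Fin n) E).map σ)ᵀ * (J : Matrix (Fin n) (Fin n) E) * (u : Matrix (Fin n) (Fin n) E) = J :=
    mem_unitaryGroupOfForm_iff.1 hu
  -- `Λ(u) = u · Λ(1)`
  have hΛ : Submodule.span 𝒪[E] (Set.range ((u : Matrix (Fin n) (Fin n) E))ᵀ) =
      (Submodule.span 𝒪[E] (Set.range (1 : Matrix (Fin n) (Fin n) E)ᵀ)).map
        ((Matrix.toLin' (u : Matrix (Fin n) (Fin n) E)).restrictScalars 𝒪[E]) := by
    rw [← span_range_transpose_mul, Matrix.mul_one]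
  have hJint : ∀ i j, (J : Matrix (Fin n) (Fin n) E) i j ∈ 𝒪[E] := ((mem_glInt_iff J).1 hJ).1
  have hJinv : ∀ i j, ((J⁻¹ : GL (Fin n) E) : Matrix (Fin n) (Fin n) E) i j ∈ 𝒪[E] := ((mem_glInt_iff J).1 hJ).2
  constructor
  · intro hx y hy
    rw [hΛ] at hx hy
    obtain ⟨c, hc, rfl⟩ := Submodule.mem_map.1 hy
    obtain ⟨d, hd, rfl⟩ := Submodule.mem_map.1 hx
    rw [mem_span_range_transpose_one_iff] at hc hd
    simp only [LinearMap.coe_restrictScalars, Matrix.toLin'_apply]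
    rw [dotProduct_map_mulVec_eq, Matrix.mulVec_mulVec, Matrix.mulVec_mulVec, hU]
    exact dotProduct_mulVec_mem_integer (fun i => hσO ⟨c i, hc i⟩) hd hJint
  · intro h
    -- test against the columns `u e_j`: `v := σ(u)ᵀ J x` is integral
    have hv : ∀ j, ((((u : Matrix (Fin n) (Fin n) E).map σ)ᵀ * (J : Matrix (Fin n) (Fin n) E)) *ᵥ x) j ∈ 𝒪[E] := by
      intro j
      have hcol : ((u : Matrix (Fin n) (Fin n) E))ᵀ j ∈ Submodule.span 𝒪[E] (Set.range ((u : Matrix (Fin n) (Fin n) E))ᵀ) :=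
        Submodule.subset_span ⟨j, rfl⟩
      have h1 := h _ hcol
      have hcolmv : ((u : Matrix (Fin n) (Fin n) E))ᵀ j = (u : Matrix (Fin n) (Fin n) E) *ᵥ Pi.single j 1 := by
        funext i; simp [Matrix.mulVec, dotProduct, Matrix.transpose_apply, Pi.single_apply]
      rw [hcolmv, dotProduct_map_mulVec_eq, Matrix.mulVec_mulVec] at h1
      have hσe : (fun i => σ ((Pi.single j (1 : E) : Fin n → E) i)) = Pi.single j 1 := by
        funext i; by_cases hij : i = j <;> simp [hij]
      rwa [hσe, single_one_dotProduct] at h1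
    -- `σ(u)ᵀ J = J u⁻¹`, so `d := u⁻¹ x = J⁻¹ · (σ(u)ᵀ J x)` is integral and `x = u d ∈ Λ(u)`
    have hUJ : ((u : Matrix (Fin n) (Fin n) E).map σ)ᵀ * (J : Matrix (Fin n) (Fin n) E) =
        (J : Matrix (Fin n) (Fin n) E) * ((u⁻¹ : GL (Fin n) E) : Matrix (Fin n) (Fin n) E) := by
      calc ((u : Matrix (Fin n) (Fin n) E).map σ)ᵀ * (J : Matrix (Fin n) (Fin n) E)
          = ((u : Matrix (Fin n) (Fin n) E).map σ)ᵀ * (J : Matrix (Fin n) (Fin n) E) *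
              ((u : Matrix (Fin n) (Fin n) E) * ((u⁻¹ : GL (Fin n) E) : Matrix (Fin n) (Fin n) E)) := by rw [Units.mul_inv, Matrix.mul_one]
        _ = ((u : Matrix (Fin n) (Fin n) E).map σ)ᵀ * (J : Matrix (Fin n) (Fin n) E) * (u : Matrix (Fin n) (Fin n) E) *
              ((u⁻¹ : GL (Fin n) E) : Matrix (Fin n) (Fin n) E) := by simp only [Matrix.mul_assoc]
        _ = (J : Matrix (Fin n) (Fin n) E) * ((u⁻¹ : GL (Fin n) E) : Matrix (Fin n) (Fin n) E) := by rw [hU]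
    have hdint : ∀ i, (((u⁻¹ : GL (Fin n) E) : Matrix (Fin n) (Fin n) E) *ᵥ x) i ∈ 𝒪[E] := by
      have hd' : ((u⁻¹ : GL (Fin n) E) : Matrix (Fin n) (Fin n) E) *ᵥ x =
          ((J⁻¹ : GL (Fin n) E) : Matrix (Fin n) (Fin n) E) *ᵥ ((((u : Matrix (Fin n) (Fin n) E).map σ)ᵀ * (J : Matrix (Fin n) (Fin n) E)) *ᵥ x) := by
        rw [hUJ, Matrix.mulVec_mulVec, ← Matrix.mul_assoc, Units.inv_mul, Matrix.one_mul]
      rw [hd']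
      exact mulVec_apply_mem_integer_of_forall hv hJinv
    have hx : x = (u : Matrix (Fin n) (Fin n) E) *ᵥ (((u⁻¹ : GL (Fin n) E) : Matrix (Fin n) (Fin n) E) *ᵥ x) := by
      rw [Matrix.mulVec_mulVec, Units.mul_inv, Matrix.one_mulVec]
    rw [hΛ, hx]
    exact Submodule.mem_map.2 ⟨_, (mem_span_range_transpose_one_iff _).2 hdint, rfl⟩

end SelfDual


/-! ## §3 Three generators to two in a plane, and the quadratic relation of an independent pair -/

section ThreeToTwo

variable {E : Type*} [Field E] [ValuativeRel E] {V : Type*} [AddCommGroup V] [Module E V]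

/-- One step of (T3): if `p, q` are `E`-independent and `r = α p + β q` with `v(β) ≤ v(α)`, then `span_𝒪{p, q, r}` is `span_𝒪{p, q}` (`α ∈ 𝒪`, hence `β ∈ 𝒪`) or
`span_𝒪{q, r}` (`α ∉ 𝒪`: `p = α⁻¹ r − (β∕α) q` with `α⁻¹, β∕α ∈ 𝒪`). [cite: Serre1980Trees, Ch. II §1.1] -/
theorem exists_span_triple_eq_span_pair_of_le (p q r : V) (hpq : LinearIndependent E ![p, q]) (α β : E) (hr : r = α • p + β • q)
    (hle : ValuativeRel.valuation E β ≤ ValuativeRel.valuation E α) :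
    ∃ a b : V, LinearIndependent E ![a, b] ∧ Submodule.span 𝒪[E] ({p, q, r} : Set V) = Submodule.span 𝒪[E] {a, b} := by
  by_cases hα : α ∈ 𝒪[E]
  · -- both coefficients integral: drop `r`
    have hβ : β ∈ 𝒪[E] := (Valuation.mem_integer_iff _ _).2 (hle.trans ((Valuation.mem_integer_iff _ _).1 hα))
    refine ⟨p, q, hpq, ?_⟩
    have hrmem : r ∈ Submodule.span 𝒪[E] ({p, q} : Set V) := Submodule.mem_span_pair.2 ⟨⟨α, hα⟩, ⟨β, hβ⟩, by rw [hr]; rfl⟩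
    rw [show ({p, q, r} : Set V) = insert r {p, q} by ext; simp only [Set.mem_insert_iff, Set.mem_singleton_iff]; tauto,
      Submodule.span_insert_eq_span hrmem]
  · -- `α ∉ 𝒪`: then `α⁻¹ ∈ 𝒪`, `β∕α ∈ 𝒪`, `p = α⁻¹ • r - (β∕α) • q`; drop `p`
    have h1 : 1 < ValuativeRel.valuation E α := lt_of_not_ge fun h => hα ((Valuation.mem_integer_iff _ _).2 h)
    have hα0 : α ≠ 0 := by rintro rfl; simp at h1
    have hinv : α⁻¹ ∈ 𝒪[E] := by
      rw [Valuation.mem_integer_iff, map_inv₀]; exact inv_le_one_of_one_le₀ h1.le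
    have hdiv : -(β / α) ∈ 𝒪[E] := by
      refine neg_mem ?_
      rw [Valuation.mem_integer_iff, map_div₀]; exact div_le_one_of_le₀ hle zero_le
    have hpmem : p ∈ Submodule.span 𝒪[E] ({q, r} : Set V) := by
      refine Submodule.mem_span_pair.2 ⟨⟨-(β / α), hdiv⟩, ⟨α⁻¹, hinv⟩, ?_⟩
      change (-(β / α)) • q + α⁻¹ • r = p
      rw [hr, smul_add, smul_smul, smul_smul, inv_mul_cancel₀ hα0, one_smul, neg_smul, show α⁻¹ * β = β / α by rw [div_eq_inv_mul]]
      abel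
    refine ⟨q, r, ?_, ?_⟩
    · rw [LinearIndependent.pair_iff] at hpq ⊢
      intro s t hst
      rw [hr, smul_add, smul_smul, smul_smul, ← add_assoc, add_comm (s • q), add_assoc, ← add_smul] at hst
      obtain ⟨h1', h2'⟩ := hpq (t * α) (s + t * β) hst
      have ht : t = 0 := (mul_eq_zero.1 h1').resolve_right hα0
      refine ⟨?_, ht⟩
      rwa [ht, zero_mul, add_zero] at h2'
    · apply le_antisymm
      · rw [Submodule.span_le]
        rintro v (rfl | rfl | rfl)
        · exact hpmem
        · exact Submodule.subset_span (by simp)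
        · exact Submodule.subset_span (by simp)
      · exact Submodule.span_mono fun v hv => by simp only [Set.mem_insert_iff, Set.mem_singleton_iff] at hv ⊢; tauto

/-- **(T3) THREE GENERATORS TO TWO.**  If `p, q` are `E`-independent and `r = α p + β q`, then `span_𝒪{p, q, r} = span_𝒪{a, b}` for an `E`-independent pair `a, b` (two of the three: drop the
generator whose coefficient has the largest valuation — the valuation ring `𝒪` is Bézout). [cite: Serre1980Trees, Ch. II §1.1] -/
theorem exists_span_triple_eq_span_pair (p q r : V) (hpq : LinearIndependent E ![p, q]) (α β : E) (hr : r = α • p + β • q) :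
    ∃ a b : V, LinearIndependent E ![a, b] ∧ Submodule.span 𝒪[E] ({p, q, r} : Set V) = Submodule.span 𝒪[E] {a, b} := by
  rcases le_total (ValuativeRel.valuation E β) (ValuativeRel.valuation E α) with h | h
  · exact exists_span_triple_eq_span_pair_of_le p q r hpq α β hr h
  · obtain ⟨a, b, hab, heq⟩ :=
      exists_span_triple_eq_span_pair_of_le q p r (LinearIndependent.pair_symm_iff.1 hpq) β α (by rw [hr, add_comm]) h
    exact ⟨a, b, hab, by rw [← heq, Set.insert_comm]⟩

/-- **(T3, selection)** in a plane (`finrank_E V = 2`), a spanning triple `x₀, x₁, x₂` contains an `E`-independent pair and the third is their combination; with (T3),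
`span_𝒪 (range x) = span_𝒪{a, b}` for an `E`-independent pair. [cite: Serre1980Trees, Ch. II §1.1] -/
theorem exists_span_range_eq_span_pair (hV : Module.finrank E V = 2) (x : Fin 3 → V) (hx : Submodule.span E (Set.range x) = ⊤) :
    ∃ a b : V, LinearIndependent E ![a, b] ∧ Submodule.span 𝒪[E] (Set.range x) = Submodule.span 𝒪[E] {a, b} := by
  haveI : Module.Finite E V := Module.finite_of_finrank_eq_succ hV
  -- a nonzero generator `x i`
  obtain ⟨i, hi⟩ : ∃ i, x i ≠ 0 := by
    by_contra h
    simp only [not_exists, not_not] at h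
    have htop : (⊤ : Submodule E V) = ⊥ := by
      rw [← hx, Submodule.span_eq_bot]
      rintro _ ⟨l, rfl⟩
      exact h l
    have h0 : Module.finrank E V = 0 := by rw [← finrank_top, htop, finrank_bot]
    omega
  -- a generator `x j` off the line `E · x i`
  obtain ⟨j, hj⟩ : ∃ j, x j ∉ Submodule.span E ({x i} : Set V) := by
    by_contra h
    simp only [not_exists, not_not] at h
    have hle : (⊤ : Submodule E V) ≤ Submodule.span E ({x i} : Set V) := by
      rw [← hx, Submodule.span_le]
      rintro _ ⟨l, rfl⟩
      exact h l
    have h1 : Module.finrank E V ≤ 1 := by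
      rw [← finrank_top]
      exact (Submodule.finrank_mono hle).trans (finrank_span_singleton hi).le
    omega
  have hij : i ≠ j := by
    rintro rfl
    exact hj (Submodule.mem_span_singleton_self _)
  have hli : LinearIndependent E ![x i, x j] := by
    rw [LinearIndependent.pair_iff' hi]
    intro a ha
    exact hj (Submodule.mem_span_singleton.2 ⟨a, ha⟩)
  -- the third index `k` and the cover `{i, j, k} = Fin 3`
  obtain ⟨k, hcover⟩ : ∃ k : Fin 3, ∀ l : Fin 3, l = i ∨ l = j ∨ l = k := by
    have hij' : i.val ≠ j.val := fun h => hij (Fin.ext h)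
    refine ⟨⟨3 - i.val - j.val, by omega⟩, fun l => ?_⟩
    simp only [Fin.ext_iff]
    have := l.isLt; have := i.isLt; have := j.isLt
    omega
  have hrange : Set.range x = {x i, x j, x k} := by
    ext v
    constructor
    · rintro ⟨l, rfl⟩
      rcases hcover l with rfl | rfl | rfl <;> simp
    · rintro (rfl | rfl | rfl) <;> exact ⟨_, rfl⟩
  -- `x k` is an `E`-combination of the independent pair
  have htop : Submodule.span E (Set.range ![x i, x j]) = ⊤ := hli.span_eq_top_of_card_eq_finrank (by simp [hV])
  have hmem : x k ∈ Submodule.span E (Set.range ![x i, x j]) := by rw [htop]; exact Submodule.mem_top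
  obtain ⟨c, hc⟩ := (Submodule.mem_span_range_iff_exists_fun E).1 hmem
  rw [Fin.sum_univ_two] at hc
  simp only [Matrix.cons_val_zero, Matrix.cons_val_one] at hc
  obtain ⟨a, b, hab, heq⟩ := exists_span_triple_eq_span_pair (x i) (x j) (x k) hli (c 0) (c 1) hc.symm
  exact ⟨a, b, hab, by rw [hrange, heq]⟩

variable {K : Type*} [Field K] [Algebra E K]

omit [ValuativeRel E] in
/-- **(T3, quadratic relation)** an `E`-independent pair `a, b` of a two-dimensional `E`-algebra `K` satisfies `(b∕a)² = s·(b∕a) − m` for some `s, m ∈ E` (`1, b∕a` is an `E`-basis).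
[cite: Serre1980Trees, Ch. II §1.1] -/
theorem exists_sq_eq_of_linearIndependent (hK : Module.finrank E K = 2) (a b : K) (hab : LinearIndependent E ![a, b]) :
    ∃ s m : E, (b / a) * (b / a) = algebraMap E K s * (b / a) - algebraMap E K m := by
  have ha : a ≠ 0 := hab.ne_zero 0
  have hli : LinearIndependent E ![(1 : K), b / a] := by
    rw [LinearIndependent.pair_iff] at hab ⊢
    intro s t hst
    have h := congrArg (fun z => a * z) hst
    simp only [mul_add, mul_zero, Algebra.mul_smul_comm, mul_one, mul_div_cancel₀ _ ha] at h
    exact hab s t h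
  have htop : Submodule.span E (Set.range ![(1 : K), b / a]) = ⊤ := hli.span_eq_top_of_card_eq_finrank (by simp [hK])
  have hmem : (b / a) * (b / a) ∈ Submodule.span E (Set.range ![(1 : K), b / a]) := by rw [htop]; exact Submodule.mem_top
  obtain ⟨c, hc⟩ := (Submodule.mem_span_range_iff_exists_fun E).1 hmem
  rw [Fin.sum_univ_two] at hc
  simp only [Matrix.cons_val_zero, Matrix.cons_val_one] at hc
  refine ⟨c 1, -c 0, ?_⟩
  rw [← hc, map_neg, Algebra.smul_def, Algebra.smul_def, mul_one]
  ring

end ThreeToTwo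

end Literature.NumberTheory.Automorphic

end
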